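import Mathlib
import Summits.ValiantsHypothesis.ValiantsHypothesis.Theorems.MonotoneRestorationOrbitRestorationQPValueOrbitProductTerms
import Summits.ValiantsHypothesis.ValiantsHypothesis.Theorems.MonotoneRestorationOrbitRestorationQPValueOrbitClosure
import Summits.ValiantsHypothesis.ValiantsHypothesis.Theorems.MonotoneRestorationOrbitRestorationQPLevelAction
import Summits.ValiantsHypothesis.ValiantsHypothesis.Theorems.MonotoneRestorationOrbitRestorationQPCloseOrbit
import HarnessLib

/-!
# Orbit-restorability toolkit: monotonicity, finite sums, arbitrary invariants, polynomials in `U` (ORBIT currency)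

Route MonotoneRestoration, crux `OrbitRestorationQP` (stmt-ValiantsHypothesis-18293), line `depth-three-rung`, registered stub
`stub_sigmaPiSigmaKValue` (A_k).  Namespace `Summit.ValiantsHypothesis.ValiantsHypothesis.Theorems.Restorable`.  Route-independent.

The final assembly of the stub combines, at every level `n`, quasi-polynomially orbit-restorable pieces.  This file provides the glue
(all in the currency `QPOrbitRestorable c n p` of the line's Defs file):

* `qpOrbitRestorable_mono` — monotonicity in the constant `c`;
* `qpOrbitRestorable_aeval_U` — `Q(U)` is restorable with constant `5` for every univariate `Q`, `U = Σ x_{pq}`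
  (`…ValueOrbitProductTerms.qpOrbitRestorable_of_affineProductTerms` with the invariant forms `U` and `1`); `qpOrbitRestorable_C`;
* `qpOrbitRestorable_sum` — finite sums (cost `3` per summand);
* `qpOrbitRestorable_of_invariant` — EVERY diagonally invariant polynomial at level `n` is restorable with constant `n! + 5` (the
  monomial expansion; every orbit has at most `n!` elements) — the finitely many small levels of a family cost one constant.

Everything is proved. [folklore]
-/

noncomputable section

open MvPolynomial Equiv

-- `Summit.ValiantsHypothesis.ValiantsHypothesis.…` is the tree's single-conjunct layout (Sub = Summit).
set_option linter.dupNamespace false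

namespace Summit.ValiantsHypothesis.ValiantsHypothesis.Theorems

namespace Restorable

open OrbitRestorationQPDepthThreeRung ValueProducts LevelStructure

variable {n : ℕ}

/-! ### Monotonicity -/

/-- The orbit bound is monotone in the constant. [folklore] -/
theorem bound_mono {c c' : ℕ} (h : c ≤ c') (L : ℕ) : 2 ^ ((L + c) ^ c) ≤ 2 ^ ((L + c') ^ c') := by
  refine Nat.pow_le_pow_right (by norm_num) ?_
  rcases Nat.eq_zero_or_pos c' with rfl | hc'
  · have : c = 0 := by omega
    subst this; exact le_rfl
  · exact (Nat.pow_le_pow_left (by omega) c).trans (Nat.pow_le_pow_right (by omega) h)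

/-- **Monotonicity of `QPOrbitRestorable` in the constant.** [folklore] -/
theorem qpOrbitRestorable_mono {c c' : ℕ} (h : c ≤ c') {p : MvPolynomial (Fin n × Fin n) ℂ} (hp : QPOrbitRestorable c n p) :
    QPOrbitRestorable c' n p := by
  obtain ⟨G, hG, C, hs, hev, horb⟩ := hp
  exact ⟨G, hG, C, hs, hev, horb.trans (bound_mono h _)⟩

/-! ### Ranges over the symmetric group -/

/-- `n! ≤ 2^((L + n!)^(n!))`. [folklore] -/
theorem factorial_le_bound (n L : ℕ) : n.factorial ≤ 2 ^ ((L + n.factorial) ^ n.factorial) := by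
  have h1 : n.factorial ≤ (L + n.factorial) ^ n.factorial :=
    (Nat.le_add_left _ _).trans (Nat.le_self_pow (Nat.factorial_pos n).ne' _)
  exact h1.trans Nat.lt_two_pow_self.le

/-- Every range over `Sym(Fin n)` is within the orbit bound for the constant `n!`. [folklore] -/
theorem ncard_range_perm_le {β : Type*} (f : Perm (Fin n) → β) :
    (Set.range f).ncard ≤ 2 ^ ((Nat.log 2 n + n.factorial) ^ n.factorial) :=
  (PatternClose.ncard_range_le_card f).trans (by rw [Fintype.card_perm, Fintype.card_fin]; exact factorial_le_bound n _)

/-! ### Padded powers -/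

/-- `Π_{i < M} (if i < t then y else 1) = y^t` for `t ≤ M`. [folklore] -/
theorem prod_ite_lt_eq_pow {R : Type*} [CommMonoid R] (y : R) {M t : ℕ} (ht : t ≤ M) :
    ∏ i : Fin M, (if (i : ℕ) < t then y else 1) = y ^ t := by
  rw [Fin.prod_univ_eq_prod_range (fun i => if i < t then y else (1 : R)) M, Finset.prod_ite, Finset.prod_const_one, mul_one,
    Finset.prod_const]
  congr 1
  rw [Finset.range_eq_Ico, Finset.Ico_filter_lt, min_eq_right ht, Nat.Ico_zero_eq_range, Finset.card_range]

/-! ### Polynomials in `U` -/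

/-- `U` is diagonally invariant. [folklore] -/
theorem ren_U (σ : Perm (Fin n)) : ren σ (U n) = U n := by
  rw [ren_eq_mact]; exact mact_U σ σ

/-- **`Q(U)` is orbit-restorable with constant `5`.** [folklore] -/
theorem qpOrbitRestorable_aeval_U (Q : Polynomial ℂ) : QPOrbitRestorable 5 n (Polynomial.aeval (U n) Q) := by
  classical
  set d := Q.natDegree with hd
  let w₀ : Fin (d + 1) → Fin (d + 1) → ℂ := fun s i => if (i : ℕ) < s then 0 else 1
  let w : Fin (d + 1) → Fin (d + 1) → (Fin n × Fin n) → ℂ := fun s i _ => if (i : ℕ) < s then 1 else 0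
  have hform : ∀ s i, affineForm w₀ w s i = if (i : ℕ) < s then U n else 1 := by
    intro s i
    simp only [affineForm, w₀, w]
    split_ifs with h
    · simp [U]
    · simp
  have hfixform : ∀ s i (σ : Perm (Fin n)), ren σ (affineForm w₀ w s i) = affineForm w₀ w s i := by
    intro s i σ; rw [hform]; split_ifs
    · exact ren_U σ
    · exact ren_C σ 1
  have hf : Polynomial.aeval (U n) Q = ∑ s : Fin (d + 1), C (Q.coeff s) * ∏ i : Fin (d + 1), affineForm w₀ w s i := by
    rw [Polynomial.aeval_eq_sum_range, Finset.sum_range]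
    refine Finset.sum_congr rfl fun s _ => ?_
    simp only [hform]
    rw [prod_ite_lt_eq_pow _ (le_of_lt s.isLt), MvPolynomial.smul_eq_C_mul]
  have hfix : ∀ σ : Perm (Fin n), ren σ (Polynomial.aeval (U n) Q) = Polynomial.aeval (U n) Q := fun σ => by
    rw [← AlgHom.coe_coe (ren σ), ← Polynomial.aeval_algHom_apply]
    simp only [AlgHom.coe_coe, ren_U]
  refine qpOrbitRestorable_of_affineProductTerms (c := 0) w₀ w (fun s => Q.coeff s) (fun s i => ?_) (fun s => ?_) hf hfix
  · refine le_trans (ValueOrbit.ncard_orbit_of_invariant (hfixform s i)) Nat.one_le_two_pow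
  · have : (Set.range fun σ : Perm (Fin n) => ((Finset.univ : Finset (Fin (d + 1))).val.map (affineForm w₀ w s)).map (ren σ)) =
        {(Finset.univ : Finset (Fin (d + 1))).val.map (affineForm w₀ w s)} := by
      ext M
      simp only [Set.mem_range, Set.mem_singleton_iff, Multiset.map_map, Function.comp_def, hfixform]
      exact ⟨fun ⟨_, h⟩ => h.symm, fun h => ⟨1, h.symm⟩⟩
    rw [this, Set.ncard_singleton]; exact Nat.one_le_two_pow

/-- Constants are orbit-restorable with constant `5`. [folklore] -/
theorem qpOrbitRestorable_C (a : ℂ) : QPOrbitRestorable 5 n (C a) := by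
  have := qpOrbitRestorable_aeval_U (n := n) (Polynomial.C a)
  rwa [Polynomial.aeval_C, MvPolynomial.algebraMap_eq] at this

/-! ### Finite sums -/

/-- **Finite sums of restorable polynomials are restorable** (cost `3` per summand; base constant `≥ 5`). [folklore] -/
theorem qpOrbitRestorable_sum {c : ℕ} (hc : 5 ≤ c) :
    ∀ (m : ℕ) (p : Fin m → MvPolynomial (Fin n × Fin n) ℂ), (∀ j, QPOrbitRestorable c n (p j)) →
      QPOrbitRestorable (c + 3 * m) n (∑ j, p j) := by
  intro m
  induction m with
  | zero =>
    intro p _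
    rw [Finset.univ_eq_empty, Finset.sum_empty, ← C_0]
    exact qpOrbitRestorable_mono (by omega) (qpOrbitRestorable_C 0)
  | succ m ih =>
    intro p hp
    rw [Fin.sum_univ_castSucc]
    have h1 : QPOrbitRestorable (c + 3 * m) n (∑ j : Fin m, p (Fin.castSucc j)) := ih _ fun j => hp _
    have h2 : QPOrbitRestorable (c + 3 * m) n (p (Fin.last m)) := qpOrbitRestorable_mono (by omega) (hp _)
    have := ValueOrbit.qpOrbitRestorable_add h1 h2
    exact qpOrbitRestorable_mono (by omega) this

/-! ### Every invariant polynomial is restorable at its own level -/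

/-- **Every diagonally invariant polynomial on the `n × n` matrix is orbit-restorable with constant `n! + 5`** (monomial expansion:
all orbits have at most `n!` elements). [folklore] -/
theorem qpOrbitRestorable_of_invariant (p : MvPolynomial (Fin n × Fin n) ℂ) (hp : ∀ σ : Perm (Fin n), ren σ p = p) :
    QPOrbitRestorable (n.factorial + 5) n p := by
  classical
  set D := p.totalDegree with hD
  let τ := ↥p.support
  let ι := (Fin n × Fin n) × Fin (D + 1)
  let w₀ : τ → ι → ℂ := fun s i => if (i.2 : ℕ) < s.1 i.1 then 0 else 1
  let w : τ → ι → (Fin n × Fin n) → ℂ := fun s i x => if (i.2 : ℕ) < s.1 i.1 ∧ x = i.1 then 1 else 0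
  have hform : ∀ (s : τ) (i : ι), affineForm w₀ w s i = if (i.2 : ℕ) < s.1 i.1 then X i.1 else 1 := by
    intro s i
    by_cases h : (i.2 : ℕ) < s.1 i.1
    · simp [affineForm, w₀, w, h, Finset.sum_ite_eq']
    · simp [affineForm, w₀, w, h]
  have hmon : ∀ s : τ, ∏ i : ι, affineForm w₀ w s i = monomial s.1 1 := by
    intro s
    simp only [hform]
    rw [Fintype.prod_prod_type]
    simp only []
    rw [monomial_eq, C_1, one_mul, Finsupp.prod_fintype _ _ (fun x => pow_zero _)]
    refine Finset.prod_congr rfl fun x _ => prod_ite_lt_eq_pow _ ?_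
    have := Finsupp.le_degree x s.1
    have h2 : s.1.degree ≤ D := by
      rw [hD]; exact le_totalDegree (s.2)
    omega
  have hf : p = ∑ s : τ, C (coeff s.1 p) * ∏ i : ι, affineForm w₀ w s i := by
    simp only [hmon]
    conv_lhs => rw [as_sum p, ← Finset.sum_coe_sort]
    refine Finset.sum_congr rfl fun s _ => ?_
    rw [← smul_eq_C_mul, smul_monomial, smul_eq_mul, mul_one]
  exact qpOrbitRestorable_of_affineProductTerms (c := n.factorial) w₀ w (fun s => coeff s.1 p)
    (fun s i => ncard_range_perm_le _) (fun s => ncard_range_perm_le _) hf hp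

end Restorable

end Summit.ValiantsHypothesis.ValiantsHypothesis.Theorems

end
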